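import Literature.AlgebraicGeometry.Frobenioids.Thm49StrictlyRationalWLOG
import Literature.AlgebraicGeometry.Frobenioids.Thm42SubWeak
import HarnessLib

/-!
# [FrdI] Theorem 4.9, row T49-L05 `PerfectStrictlyRationalWLOG` ("we may assume that `A` is strictly rational")
# in the WEAK setting

Mochizuki, *The geometry of Frobenioids I: the general theory*, Kyushu J. Math. **62** (2008)
293–400, §4, proof of Theorem 4.9, p. 89 ll. 38–46 [cite: MochizukiFrdI2008, Thm. 4.9 p.89].

PROOF-ONLY file (cell abc-iut, layer L1, seat abc-iut-L1-t14; row «C411iii/iv-WEAK» = the [FrdI] Thm. 4.9 /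
Cor. 4.11 (iii)(iv) chain over `IsPerfFactorialWeak`, block (T2)). WEAK-HYPOTHESIS TWIN of the one
`T42.Setting`-typed theorem of `Thm49StrictlyRationalWLOG.lean` (seat abc-iut-w4-d109),
`FrdI.T49.leftHand_of_leftHand_of_isPullbackMorphism_weak`, now over `FrdI.T42.SettingWeak`
(`Thm42SubWeak.lean`; "`Φ_i` perf-factorial" weakened to "`Φ_i` weakly perf-factorial", Def. 2.4 (i)
(a)(b)(c) + (d_ord) + (d_res); cell finding F-L2d2-1). The hypothesis-free
`rightHand_natural_of_isPullbackMorphism` is consumed BY NAME; only the fields `isFrobenioid_i`, `isotropic₁`,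
`pullback_map` of the setting enter, so the proof is verbatim. No new definitions; nothing of the paper restated
or strengthened; nothing here is specific to the abc programme and no side is taken on [IUTchIII] Cor. 3.12.
-/

namespace Literature.AlgebraicGeometry.Frobenioids

open CategoryTheory Opposite

namespace FrdI.T49

universe w v v' u u'

variable {D₁ : Type u} [Category.{v} D₁] {Φ₁ : D₁ᵒᵖ ⥤ CommMonCat.{w}} {C₁ : Type u'} [Category.{v'} C₁]
  {D₂ : Type u} [Category.{v} D₂] {Φ₂ : D₂ᵒᵖ ⥤ CommMonCat.{w}} {C₂ : Type u'} [Category.{v'} C₂]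
  {F₁ : C₁ ⥤ ElemFrobenioid Φ₁} {F₂ : C₂ ⥤ ElemFrobenioid Φ₂} {Ψ : C₁ ≌ C₂}

/-- (WEAK setting: `T42.SettingWeak`, weakly perf-factorial `Φ_i`; twin of the strong lemma of the same name without `_weak`.) **T49-L05 `PerfectStrictlyRationalWLOG` — "we may assume without loss of generality that `A` is strictly
rational"** (p. 89 ll. 38–46), in EXACTLY the binders of seat abc-iut-w5-d021's typed row: in the setting of
the proof of Thm. 4.2 (perfect and isotropic type, `Φ_i` perf-factorial, the Thm. 3.4 (ii)(iii) transports),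
for a pull-back morphism `ψ : A′ → A` and isomorphisms of monoids `m′ : Φ₁(A′) ≃ Φ₂(Ψ A′)`,
`m : Φ₁(A) ≃ Φ₂(Ψ A)` having the RIGHT-hand property (on pre-steps out of `A′`, resp. `A`), the LEFT-hand
property of `m′` at `A′` ("`Base(Ψ χ)^* (m′ y) = Div(Ψ χ)` whenever `Base(χ)^* y = Div χ`, for co-angular
pre-steps `χ` into `A′`") implies the left-hand property of `m` at `A`. Hence right = left at a strictly
rational `A′` transfers to every rational `A` (Def. 4.5 (ii): a pull-back morphism `A′ → A` exists).
[cite: MochizukiFrdI2008, Thm. 4.9 p.89] -/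
theorem leftHand_of_leftHand_of_isPullbackMorphism_weak (F₁ : C₁ ⥤ ElemFrobenioid Φ₁)
    (F₂ : C₂ ⥤ ElemFrobenioid Φ₂) (Ψ : C₁ ≌ C₂) (S : T42.SettingWeak F₁ F₂ Ψ)
    {A' A : C₁} (ψ : A' ⟶ A) (hψ : PreFrobenioid.IsPullbackMorphism F₁ ψ)
    (m' : Φ₁.obj (op (PreFrobenioid.baseObj F₁ A')) ≃* Φ₂.obj (op (PreFrobenioid.baseObj F₂ (Ψ.functor.obj A'))))
    (m : Φ₁.obj (op (PreFrobenioid.baseObj F₁ A)) ≃* Φ₂.obj (op (PreFrobenioid.baseObj F₂ (Ψ.functor.obj A))))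
    (hm' : ∀ ⦃B' : C₁⦄ (θ : A' ⟶ B'), PreFrobenioid.IsPreStep F₁ θ →
      m' (PreFrobenioid.Div F₁ θ) = PreFrobenioid.Div F₂ (Ψ.functor.map θ))
    (hm : ∀ ⦃B : C₁⦄ (φ : A ⟶ B), PreFrobenioid.IsPreStep F₁ φ →
      m (PreFrobenioid.Div F₁ φ) = PreFrobenioid.Div F₂ (Ψ.functor.map φ))
    (hleft' : ∀ ⦃B' : C₁⦄ (χ : B' ⟶ A'), PreFrobenioid.IsCoAngularPreStep F₁ χ →
      ∀ y : Φ₁.obj (op (PreFrobenioid.baseObj F₁ A')),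
        pull Φ₁ (PreFrobenioid.Base F₁ χ) y = PreFrobenioid.Div F₁ χ →
          pull Φ₂ (PreFrobenioid.Base F₂ (Ψ.functor.map χ)) (m' y) = PreFrobenioid.Div F₂ (Ψ.functor.map χ))
    ⦃B : C₁⦄ (χ : B ⟶ A) (hχ : PreFrobenioid.IsCoAngularPreStep F₁ χ)
    (y : Φ₁.obj (op (PreFrobenioid.baseObj F₁ A)))
    (hy : pull Φ₁ (PreFrobenioid.Base F₁ χ) y = PreFrobenioid.Div F₁ χ) :
    pull Φ₂ (PreFrobenioid.Base F₂ (Ψ.functor.map χ)) (m y) = PreFrobenioid.Div F₂ (Ψ.functor.map χ) := by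
  have hF₁ := S.isFrobenioid₁
  have hF₂ := S.isFrobenioid₂
  -- pull `χ` back along `ψ` (Prop. 1.11 (v)): `α ≫ ψ = l ≫ χ`, `α` a co-angular pre-step into `A′`, `l` a
  -- pull-back morphism
  obtain ⟨W, α, l, hα, hl, hsq⟩ :=
    PreFrobenioid.exists_preStep_pullback_square hF₁ S.isotropic₁ ψ hψ χ hχ
  -- zero divisors in the square: `Div α = Base(l)^* Div χ`
  have hdivα : PreFrobenioid.Div F₁ α = pull Φ₁ (PreFrobenioid.Base F₁ l) (PreFrobenioid.Div F₁ χ) :=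
    PreFrobenioid.div_eq_pull_div_of_pullback_square hF₁ hl hψ hsq
  -- the left-hand hypothesis at `A′` applies to `(α, Base(ψ)^* y)`
  have hy' : pull Φ₁ (PreFrobenioid.Base F₁ α) (pull Φ₁ (PreFrobenioid.Base F₁ ψ) y) =
      PreFrobenioid.Div F₁ α := by
    rw [← pull_comp, ← PreFrobenioid.base_comp, hsq, PreFrobenioid.base_comp, pull_comp, hy, hdivα]
  have h1 := hleft' α hα _ hy'
  -- naturality of the right-hand maps along `ψ`
  have hnat : m' (pull Φ₁ (PreFrobenioid.Base F₁ ψ) y) =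
      pull Φ₂ (PreFrobenioid.Base F₂ (Ψ.functor.map ψ)) (m y) :=
    rightHand_natural_of_isPullbackMorphism hF₁ hF₂ S.pullback_map ψ hψ m' m
      (fun _ θ hθ => hm' θ hθ.2) (fun _ φ hφ => hm φ hφ.2) y
  rw [hnat, ← pull_comp, ← PreFrobenioid.base_comp, ← Ψ.functor.map_comp, hsq, Ψ.functor.map_comp,
    PreFrobenioid.base_comp, pull_comp] at h1
  -- the square in `C₂`: `Div(Ψ α) = Base(Ψ l)^* Div(Ψ χ)`
  have hsq₂ : Ψ.functor.map α ≫ Ψ.functor.map ψ = Ψ.functor.map l ≫ Ψ.functor.map χ := by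
    rw [← Ψ.functor.map_comp, hsq, Ψ.functor.map_comp]
  have hdivα₂ : PreFrobenioid.Div F₂ (Ψ.functor.map α) =
      pull Φ₂ (PreFrobenioid.Base F₂ (Ψ.functor.map l)) (PreFrobenioid.Div F₂ (Ψ.functor.map χ)) :=
    PreFrobenioid.div_eq_pull_div_of_pullback_square hF₂ (S.pullback_map l hl) (S.pullback_map ψ hψ) hsq₂
  rw [hdivα₂] at h1
  -- cancel `Base(Ψ l)^*` (Def. 1.1 (ii)(a): pull-backs of the divisor monoid are injective)
  exact (hF₂.isPreFrobenioid.isMonoidOn.isCharInjective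
    (PreFrobenioid.Base F₂ (Ψ.functor.map l))).1 h1

end FrdI.T49

end Literature.AlgebraicGeometry.Frobenioids
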